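import Literature.Analysis.FluidPDE.DeRosaPerturbation
import Literature.Analysis.FluidPDE.FractionalNSReynoldsInitial
import Literature.Analysis.FluidPDE.FracNSEnergy
import HarnessLib

/-!
# De Rosa's perturbation stage: the new triple solves the fractional NSR system (§5.5) — part 2

L. De Rosa, *Infinitely many Leray–Hopf solutions for the fractional Navier–Stokes equations*,
Comm. PDE 44 (2019) 335–365 = arXiv:1801.10235, §5.5: with the new stress
`R̊_{q+1} = R̊^E_{q+1} + R̊^D_{q+1}` ((5.38)–(5.40)), "due to the dissipative term `(-Δ)^γ` we have
to put also `R̊^D_{q+1}` in the definition of the new Reynolds stress in order to ensure that the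
system (NSR) is satisfied at the step `q+1`. Indeed, with this definition one may verify that
`∂ₜv_{q+1} + div(v_{q+1} ⊗ v_{q+1}) + ∇p_{q+1} + ν(-Δ)^γ v_{q+1} = div R̊_{q+1}`, `div v_{q+1} = 0`,
where the new pressure is defined by `p_{q+1} = p̄_q - ∑ᵢ ρ_{q,i} + ρ_q`."

This file PROVES that verification for the honest construction of `OnsagerBDSVPerturbation.lean`
with De Rosa's stress `DeRosa.newStress` (`DeRosaPerturbation.lean`), and discharges part 2 of
`DeRosa.perturbationStage_of_parts`:

* `Torus.IsSmoothSpaceTimeOn.fracLaplacian` — joint smoothness of `t ↦ (-Δ)^γ(u t)` on a convex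
  time set with nonempty interior (the tree's `…fracLaplacian_univ`, localised to e.g. `[0,T]`);
* `BDSV.SmoothData.isFracNSReynoldsOn_newTriple` — the (NSR) system for
  `(v̄_q + w_{q+1}, p_{q+1}, R̊^E_{q+1} + R̊^D_{q+1})`: the Euler bookkeeping of BDSV §5.4
  (the computation of `BDSV.SmoothData.momentum_newTriple`: `div ℛF = F`, `div(w ⊗ w) = (w·∇)w`,
  `div(ρ Id) = ∇ρ`, `(∑ᵢηᵢ²)R̊̄_q = R̊̄_q`) plus the two fractional facts
  `(-Δ)^γ(v̄_q + w) = (-Δ)^γ v̄_q + (-Δ)^γ w` and `div R̊^D = ν(-Δ)^γ w` (`ℛ` inverts the divergence on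
  mean-free fields, BDSV Prop. 4.1 = `Torus.tensorDivergence_antidivergence`, and `(-Δ)^γ w` has
  zero mean, `Torus.integral_fracLaplacian_eq_zero`);
* `DeRosa.nsrPart_proof` — part 2 for every Mikado datum and all cut-off constants, with
  `α₀ = βb(b-1)` and the threshold of `BDSV.exists_threshold_amp_succ_succ` making `ρ_q > 0`
  (exactly as in `BDSV.newTriple_isEulerReynolds_holds`).

## References

* L. De Rosa, Comm. PDE 44 (2019) 335–365 = arXiv:1801.10235, §5.5 ((5.38)–(5.40), the (NSR)
  system for the new triple and the new pressure). [`Derosa2018`]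
* T. Buckmaster, C. De Lellis, L. Székelyhidi Jr., V. Vicol, CPAM 72 (2019) = arXiv:1701.08678,
  §5.4 (5.23)–(5.24), Prop. 4.1. [`BuckmasterEtAl2018`]
-/

open MeasureTheory Set
open scoped NNReal ENNReal ContDiff Matrix Matrix.Norms.Elementwise InnerProductSpace Convolution

noncomputable section

namespace Literature.Analysis.FluidPDE

/-! ## Joint smoothness of `(-Δ)^γ` on general time sets -/

namespace Torus

open FunctionSpaces FunctionSpaces.Torus

variable {d : Type*} [Fintype d] [DecidableEq d]

/-- The elliptic iterate `(1 - (4π²)⁻¹Δ)^m u` of a jointly smooth field is jointly smooth, on any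
time set of unique differentiability. [folklore] -/
theorem isSmoothSpaceTimeOn_iterate_of_uniqueDiffOn {S : Set ℝ} (hS : UniqueDiffOn ℝ S)
    {ψ : ℝ → UnitAddTorus d → EuclideanSpace ℝ d} (hψ : Torus.IsSmoothSpaceTimeOn S ψ) (m : ℕ) :
    Torus.IsSmoothSpaceTimeOn S ((fun c : ℝ → UnitAddTorus d → EuclideanSpace ℝ d =>
        fun s x => c s x - (4 * Real.pi ^ 2)⁻¹ • Torus.laplacian (c s) x)^[m] ψ) := by
  induction m generalizing ψ with
  | zero => exact hψ
  | succ m ih =>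
    rw [Function.iterate_succ_apply]
    exact ih (hψ.sub ((hψ.laplacian hS).const_smul _))

/-- **Joint space–time smoothness of `(-Δ)^α` on a convex time set with nonempty interior**
(`[0,T]` with `T > 0` in the scheme): for `u` jointly smooth on `S × T^d` and `α ≥ 0`, the field
`t ↦ (-Δ)^α (u t)` is jointly smooth on `S × T^d` (slice-wise `(-Δ)^α = K_α ⋆ (1 - (4π²)⁻¹Δ)^M`,
`Torus.fracLaplacian_eq_convolution`; mollification in space of a jointly smooth field is jointly
smooth, `Torus.IsSmoothSpaceTimeOn.convolution`). [folklore] -/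
theorem _root_.Literature.Analysis.FunctionSpaces.Torus.IsSmoothSpaceTimeOn.fracLaplacian
    {θ : ℝ} (hθ : 0 ≤ θ) {S : Set ℝ} (hS : Convex ℝ S) (hSi : (interior S).Nonempty)
    {u : ℝ → UnitAddTorus d → EuclideanSpace ℝ d} (hu : Torus.IsSmoothSpaceTimeOn S u) :
    Torus.IsSmoothSpaceTimeOn S (fun t => fracLaplacian θ (u t)) := by
  have hU : UniqueDiffOn ℝ S := uniqueDiffOn_convex hS hSi
  set M := fracKerOrder θ d with hM_def
  set w : ℝ → UnitAddTorus d → EuclideanSpace ℝ d :=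
    (fun c : ℝ → UnitAddTorus d → EuclideanSpace ℝ d =>
      fun s x => c s x - (4 * Real.pi ^ 2)⁻¹ • Torus.laplacian (c s) x)^[M] u with hw
  have h1 : Torus.IsSmoothSpaceTimeOn S (fun t => fracKernel θ ⋆ w t) :=
    (isSmoothSpaceTimeOn_iterate_of_uniqueDiffOn hU hu M).convolution (integrable_fracKernel hθ) hS hSi
  refine ContDiffOn.congr h1 ?_
  rintro ⟨t, y⟩ hz
  have ht : t ∈ S := (mem_prod.1 hz).1
  simp only [stLift_apply]
  rw [fracLaplacian_eq_convolution hθ (hu.isSmooth_slice ht), hw, iterate_spaceTime_slice]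
  rfl

end Torus

/-! ## The new triple solves (NSR) -/

namespace BDSV

open FunctionSpaces FunctionSpaces.Torus

/-- The flat three-torus `T³ = (ℝ/ℤ)³`, local notation. -/
local notation "𝕋³" => UnitAddTorus (Fin 3)

/-- Euclidean `ℝ³`, local notation. -/
local notation "ℝ³" => EuclideanSpace ℝ (Fin 3)

variable {P : Params} {S : Setting} {η : ℕ → ℝ → 𝕋³ → ℝ} {D : ℕ → ℝ → 𝕋³ → ℝ³}

namespace SmoothData

variable (h : SmoothData P S η D) (𝔚 : MikadoDatum mikadoRadius)
include h

/-- `t ↦ (-Δ)^γ w_{q+1}(t)` is jointly smooth on `[0,T] × 𝕋³` (`γ ≥ 0`). [folklore] -/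
theorem fracLaplacian_perturbation {γ : ℝ} (hγ : 0 ≤ γ) :
    Torus.IsSmoothSpaceTimeOn (Icc 0 S.T)
      (fun t => Torus.fracLaplacian γ (BDSV.perturbation P S 𝔚 η D t)) :=
  (h.perturbation 𝔚).fracLaplacian hγ (convex_Icc 0 S.T)
    (by rw [interior_Icc]; exact nonempty_Ioo.2 h.pos_T)

/-- The dissipative stress `R̊^D_{q+1} = νℛ((-Δ)^γ w_{q+1})` is jointly smooth on `[0,T] × 𝕋³`.
[cite: Derosa2018, §5.5 (5.40)] -/
theorem dissipativeStress {γ : ℝ} (hγ : 0 ≤ γ) (ν : ℝ) :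
    Torus.IsSmoothSpaceTimeOn (Icc 0 S.T) (DeRosa.dissipativeStress P γ ν S 𝔚 η D) :=
  ((h.fracLaplacian_perturbation 𝔚 hγ).antidivergence (convex_Icc 0 S.T)
    (by rw [interior_Icc]; exact nonempty_Ioo.2 h.pos_T)).const_smul ν

/-- De Rosa's new stress `R̊^E_{q+1} + R̊^D_{q+1}` is jointly smooth on `[0,T] × 𝕋³`.
[cite: Derosa2018, §5.5 (5.38)] -/
theorem deRosaNewStress {γ : ℝ} (hγ : 0 ≤ γ) (ν : ℝ) :
    Torus.IsSmoothSpaceTimeOn (Icc 0 S.T) (DeRosa.newStress P γ ν S 𝔚 η D) :=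
  (h.newStress 𝔚).add (h.dissipativeStress 𝔚 hγ ν)

/-- `div R̊^D_{q+1} = ν(-Δ)^γ w_{q+1}` on `[0,T]` (`γ > 0`): `div(νℛf) = ν div ℛf = ν(f - ⨍f)`
(BDSV Prop. 4.1) and `⨍(-Δ)^γ w = 0`. [cite: Derosa2018, §5.5 (div of the dissipative stress)] -/
theorem tensorDivergence_dissipativeStress {γ : ℝ} (hγ : 0 < γ) (ν : ℝ) {t : ℝ} (ht : t ∈ Icc 0 S.T)
    (x : 𝕋³) :
    Torus.tensorDivergence (DeRosa.dissipativeStress P γ ν S 𝔚 η D t) x =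
      ν • Torus.fracLaplacian γ (BDSV.perturbation P S 𝔚 η D t) x := by
  have hwt : IsSmooth (BDSV.perturbation P S 𝔚 η D t) := (h.perturbation 𝔚).isSmooth_slice ht
  have hLt : IsSmooth (Torus.fracLaplacian γ (BDSV.perturbation P S 𝔚 η D t)) :=
    hwt.fracLaplacian hγ.le
  have hA : IsSmooth (Torus.antidivergence (Torus.fracLaplacian γ (BDSV.perturbation P S 𝔚 η D t))) :=
    Torus.isSmooth_antidivergence hLt
  have e1 : Torus.tensorDivergence (DeRosa.dissipativeStress P γ ν S 𝔚 η D t) x =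
      ν • Torus.tensorDivergence
        (Torus.antidivergence (Torus.fracLaplacian γ (BDSV.perturbation P S 𝔚 η D t))) x := by
    unfold Torus.tensorDivergence DeRosa.dissipativeStress
    rw [Finset.smul_sum]
    refine Finset.sum_congr rfl fun j _ => ?_
    exact Torus.partialDeriv_const_smul_at (hA.column j).isContDiff_one ν j x
  rw [e1, Torus.tensorDivergence_antidivergence (by simp) hLt, Torus.integral_fracLaplacian_eq_zero hγ hwt,
    sub_zero]

/-- **The momentum equation of (NSR) for the new triple** on `[0,T] × 𝕋³`:
`∂ₜv_{q+1} + (v_{q+1}·∇)v_{q+1} + ∇p_{q+1} + ν(-Δ)^γ v_{q+1} = div(R̊^E_{q+1} + R̊^D_{q+1})`. Expand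
`v_{q+1} = v̄_q + w`, use the (NSR) equation of `(v̄_q, p̄_q, R̊̄_q)`, `div R̊^E = F` (§5.4 of BDSV),
`div(w ⊗ w) = (w·∇)w`, `div(ρ Id) = ∇ρ`, `(∑ᵢηᵢ²)R̊̄_q = R̊̄_q`, linearity of `(-Δ)^γ` and
`div R̊^D = ν(-Δ)^γ w`. [cite: Derosa2018, §5.5 (the (NSR) system for (v_{q+1}, p_{q+1}, R̊_{q+1}))] -/
theorem momentum_newTriple_fracNSR {γ ν : ℝ} (hγ : 0 < γ)
    (hNS : Torus.IsFracNSReynoldsOn (Icc 0 S.T) γ ν S.vbar S.pbar S.Rbar)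
    (hsupp : ∀ t ∈ Icc 0 S.T, ∀ (x : 𝕋³) (j : Fin 3),
      (∑ i ∈ Finset.range (cutoffCount S.T (P.τ S.q)), η i t x ^ 2) • S.Rbar t x j = S.Rbar t x j)
    {t : ℝ} (ht : t ∈ Icc 0 S.T) (x : 𝕋³) :
    Torus.timeDerivWithin (Icc 0 S.T) (BDSV.newVelocity P S 𝔚 η D) t x +
      Torus.convect (BDSV.newVelocity P S 𝔚 η D t) (BDSV.newVelocity P S 𝔚 η D t) x +
      Torus.gradient (BDSV.newPressure P S η t) x +
      ν • Torus.fracLaplacian γ (BDSV.newVelocity P S 𝔚 η D t) x =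
    Torus.tensorDivergence (DeRosa.newStress P γ ν S 𝔚 η D t) x := by
  -- abbreviations and smoothness
  set w := BDSV.perturbation P S 𝔚 η D with hwdef
  set v := S.vbar with hvdef
  set ρtot : 𝕋³ → ℝ := fun y => ∑ i ∈ Finset.range (cutoffCount S.T (P.τ S.q)), BDSV.rhoI P S η i t y
    with hρtot
  have hw := h.perturbation 𝔚
  have hwt : IsSmooth (w t) := hw.isSmooth_slice ht
  have hvt : IsSmooth (v t) := h.vbar.isSmooth_slice ht
  have hpt : IsSmooth (S.pbar t) := h.pbar.isSmooth_slice ht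
  have hRt : IsSmooth (S.Rbar t) := h.Rbar.isSmooth_slice ht
  have hρi : ∀ i, IsSmooth (BDSV.rhoI P S η i t) := fun i => (h.rhoI i).isSmooth_slice ht
  have hρtot : IsSmooth ρtot := Torus.isSmooth_finset_sum _ fun i _ => hρi i
  have hdivw : Torus.IsDivFree (w t) := h.isDivFree_perturbation 𝔚 ht
  have hU := h.uniqueDiffOn t ht
  -- (1) time derivative of the sum
  have e1 : Torus.timeDerivWithin (Icc 0 S.T) (BDSV.newVelocity P S 𝔚 η D) t x =
      Torus.timeDerivWithin (Icc 0 S.T) v t x + Torus.timeDerivWithin (Icc 0 S.T) w t x :=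
    ((h.vbar.hasDerivWithinAt_slice ht x).add (hw.hasDerivWithinAt_slice ht x)).derivWithin hU
  -- (2) the convective term
  have e2 : Torus.convect (BDSV.newVelocity P S 𝔚 η D t) (BDSV.newVelocity P S 𝔚 η D t) x =
      Torus.convect (v t) (v t) x + Torus.convect (w t) (v t) x +
        (Torus.convect (v t) (w t) x + Torus.convect (w t) (w t) x) := by
    show Torus.fderiv (v t + w t) x (v t x + w t x) = _
    rw [FunctionSpaces.Torus.fderiv_add hvt.isContDiff_one hwt.isContDiff_one, FunLike.coe_add, Pi.add_apply,
      map_add, map_add]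
    rfl
  -- (3) the pressure gradient
  have e3 : Torus.gradient (BDSV.newPressure P S η t) x = Torus.gradient (S.pbar t) x - Torus.gradient ρtot x := by
    have hp' : IsSmooth (BDSV.newPressure P S η t) := h.newPressure.isSmooth_slice ht
    rw [gradient_eq_sum_partialDeriv hp'.isContDiff_one, gradient_eq_sum_partialDeriv hpt.isContDiff_one,
      gradient_eq_sum_partialDeriv hρtot.isContDiff_one, ← Finset.sum_sub_distrib]
    refine Finset.sum_congr rfl fun k _ => ?_
    rw [← sub_smul]
    congr 1
    have hpc : IsSmooth (fun y => S.pbar t y + rhoQ P S t) := hpt.add (isSmooth_const _)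
    show Torus.partialDeriv k (fun y => S.pbar t y + rhoQ P S t - ρtot y) x = _
    rw [Torus.partialDeriv_sub_at hpc.isContDiff_one hρtot.isContDiff_one,
      Torus.partialDeriv_add_apply hpt.isContDiff_one (isSmooth_const (rhoQ P S t)).isContDiff_one,
      Torus.partialDeriv_const_apply, add_zero]
  -- (4) the divergence of the oscillation tensor
  have hA : IsSmooth (fun y j => w t y j • w t y) := contDiff_pi.2 fun j => (hwt.apply j).smul' hwt
  have hstress : BDSV.stressSum P S η t = fun y j => ρtot y • EuclideanSpace.single j (1 : ℝ) - S.Rbar t y j := by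
    funext y j
    rw [stressSum_apply, hsupp t ht y j]
  have hE : IsSmooth (fun _ : 𝕋³ => fun j : Fin 3 => EuclideanSpace.single j (1 : ℝ)) :=
    isSmooth_const _
  have hB1 : IsSmooth (fun y j => ρtot y • EuclideanSpace.single j (1 : ℝ)) := hρtot.smul' hE
  have hB : IsSmooth (BDSV.stressSum P S η t) := by
    rw [hstress]
    exact (hρtot.smul' hE).sub hRt
  have e4 : Torus.tensorDivergence (fun y j => w t y j • w t y - BDSV.stressSum P S η t y j) x =
      Torus.convect (w t) (w t) x - (Torus.gradient ρtot x - Torus.tensorDivergence (S.Rbar t) x) := by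
    rw [tensorDivergence_sub hA hB, tensorDivergence_smul_self hwt hdivw, hstress,
      tensorDivergence_sub hB1 hRt, tensorDivergence_smul_single hρtot]
  -- (5) the fractional Laplacian of the sum
  have e5 : Torus.fracLaplacian γ (BDSV.newVelocity P S 𝔚 η D t) x =
      Torus.fracLaplacian γ (v t) x + Torus.fracLaplacian γ (w t) x :=
    congr_fun (Torus.fracLaplacian_add hγ.le hvt hwt) x
  -- (6) the divergence of De Rosa's stress
  have hEt : IsSmooth (BDSV.newStress P S 𝔚 η D t) := (h.newStress 𝔚).isSmooth_slice ht
  have hDt : IsSmooth (DeRosa.dissipativeStress P γ ν S 𝔚 η D t) :=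
    (h.dissipativeStress 𝔚 hγ.le ν).isSmooth_slice ht
  have e6 : Torus.tensorDivergence (DeRosa.newStress P γ ν S 𝔚 η D t) x =
      BDSV.stressSource P S 𝔚 η D t x + ν • Torus.fracLaplacian γ (w t) x := by
    have : DeRosa.newStress P γ ν S 𝔚 η D t =
        fun y j => BDSV.newStress P S 𝔚 η D t y j + DeRosa.dissipativeStress P γ ν S 𝔚 η D t y j := rfl
    rw [this, tensorDivergence_add hEt hDt, h.tensorDivergence_newStress 𝔚 hNS.divFree ht,
      h.tensorDivergence_dissipativeStress 𝔚 hγ ν ht]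
  -- (7) assemble
  have hmom := hNS.momentum t ht x
  rw [e6, BDSV.stressSource, e4, e1, e2, e3, e5, smul_add]
  rw [← hmom]
  abel

/-- **The new triple solves (NSR) on `[0,T] × 𝕋³`** (De Rosa §5.5), given the smoothness and
positivity data of the construction, the (NSR) system for the input triple and the cut-off
support identity `(∑ᵢ ηᵢ²) R̊̄_q = R̊̄_q`; the new stress `R̊^E + R̊^D` is symmetric, both parts being
in the range of `ℛ`. [cite: Derosa2018, §5.5 (the (NSR) system at step q+1)] -/
theorem isFracNSReynoldsOn_newTriple {γ ν : ℝ} (hγ : 0 < γ)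
    (hNS : Torus.IsFracNSReynoldsOn (Icc 0 S.T) γ ν S.vbar S.pbar S.Rbar)
    (hsupp : ∀ t ∈ Icc 0 S.T, ∀ (x : 𝕋³) (j : Fin 3),
      (∑ i ∈ Finset.range (cutoffCount S.T (P.τ S.q)), η i t x ^ 2) • S.Rbar t x j = S.Rbar t x j) :
    Torus.IsFracNSReynoldsOn (Icc 0 S.T) γ ν (BDSV.newVelocity P S 𝔚 η D) (BDSV.newPressure P S η)
      (DeRosa.newStress P γ ν S 𝔚 η D) where
  smooth_velocity := h.newVelocity 𝔚
  smooth_pressure := h.newPressure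
  smooth_stress := h.deRosaNewStress 𝔚 hγ.le ν
  momentum t ht x := h.momentum_newTriple_fracNSR 𝔚 hγ hNS hsupp ht x
  divFree t ht x := by
    show Torus.divergence (fun y => S.vbar t y + BDSV.perturbation P S 𝔚 η D t y) x = 0
    rw [divergence_add (h.vbar.isSmooth_slice ht) ((h.perturbation 𝔚).isSmooth_slice ht),
      hNS.divFree t ht x, h.isDivFree_perturbation 𝔚 ht x, add_zero]
  symm t ht x i j := by
    have hs : IsSmooth (BDSV.stressSource P S 𝔚 η D t) := (h.stressSource 𝔚).isSmooth_slice ht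
    have hL : IsSmooth (Torus.fracLaplacian γ (BDSV.perturbation P S 𝔚 η D t)) :=
      ((h.perturbation 𝔚).isSmooth_slice ht).fracLaplacian hγ.le
    show (BDSV.newStress P S 𝔚 η D t x i + DeRosa.dissipativeStress P γ ν S 𝔚 η D t x i) j =
      (BDSV.newStress P S 𝔚 η D t x j + DeRosa.dissipativeStress P γ ν S 𝔚 η D t x j) i
    simp only [PiLp.add_apply, DeRosa.dissipativeStress, BDSV.newStress, PiLp.smul_apply, smul_eq_mul]
    rw [Torus.antidivergence_symm hs x i j, Torus.antidivergence_symm hL x i j]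

end SmoothData

end BDSV

/-! ## Part 2 of `DeRosa.perturbationStage_of_parts` -/

namespace DeRosa

open BDSV FunctionSpaces FunctionSpaces.Torus

/-- The flat three-torus `𝕋³ = (ℝ/ℤ)³`, local notation. -/
local notation "𝕋³" => UnitAddTorus (Fin 3)

/-- **Part 2: the new triple solves (NSR)** for every Mikado datum `𝔚` and all cut-off
constants `(c₀, C_η)`, `c₀ > 0` (De Rosa §5.5), with `α₀ = βb(b-1)` and `a` beyond the threshold
of `BDSV.exists_threshold_amp_succ_succ`, which with the energy gap makes `ρ_q ≥ δ_{q+2}/6 > 0`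
(BDSV Lemma 5.4 (5.15)); `∑ⱼ∫ηⱼ² ≥ c₀ > 0` is property (v) of the cut-offs.
[cite: Derosa2018, §5.5 (the (NSR) system at step q+1)] -/
theorem nsrPart_proof (𝔚 : MikadoDatum mikadoRadius) {c₀ : ℝ} (hc₀ : 0 < c₀) (Cη : ℕ → ℕ → ℝ) :
    nsrPart 𝔚 c₀ Cη := by
  intro β hβ hβ3 b hb hbβ
  refine ⟨β * b * (b - 1), by nlinarith [mul_pos hβ (by linarith : (0 : ℝ) < b)], ?_⟩
  intro α hα hαlt
  have hαb : α < 2 * β * b * (b - 1) := by nlinarith [mul_pos hβ (by linarith : (0 : ℝ) < b)]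
  obtain ⟨a₁, ha₁, hpar⟩ := exists_threshold_amp_succ_succ hb hαb
  refine ⟨a₁, ha₁, ?_⟩
  intro a ha γ hγ ν _hν θ CH Nbar Cin C₀ S H 𝒟
  have ha1 : (1 : ℝ) ≤ a := ha₁.le.trans ha
  have hτ : 0 < Params.τ ⟨β, α, a, b⟩ S.q := glueScale_pos ha1 S.q
  -- the smoothness / positivity data
  have hSD : SmoothData ⟨β, α, a, b⟩ S 𝒟.cut.η 𝒟.D :=
    { pos_T := H.pos_T
      e := H.profile.smooth
      vbar := H.fracNSR.smooth_velocity
      pbar := H.fracNSR.smooth_pressure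
      Rbar := H.fracNSR.smooth_stress
      eta := 𝒟.cut.smooth
      disp := fun i => (𝒟.flow i).smooth
      rho_pos := fun t ht => by
        have h2 := hpar a ha S.q
        have hgap := (H.energy_gap t ht).1
        have hδ : 0 < amp β a b (S.q + 2) := amp_pos ha1 _
        show 0 < (S.e t - amp β a b (S.q + 2) / 2 - ∫ x, ‖S.vbar t x‖ ^ 2) / 3
        nlinarith
      mass_pos := fun t ht => lt_of_lt_of_le hc₀ (𝒟.cut.sum_sq_ge t ht) }
  have hsupp : ∀ t ∈ Icc 0 S.T, ∀ (x : 𝕋³) (j : Fin 3),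
      (∑ i ∈ Finset.range (cutoffCount S.T (Params.τ ⟨β, α, a, b⟩ S.q)), 𝒟.cut.η i t x ^ 2) •
        S.Rbar t x j = S.Rbar t x j :=
    fun t ht x j => sum_eta_sq_smul_Rbar hτ 𝒟.cut H.stress_support ht x j
  exact hSD.isFracNSReynoldsOn_newTriple 𝔚 hγ H.fracNSR hsupp

end DeRosa

end Literature.Analysis.FluidPDE
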